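import Summits.SmoothPoincare4.SmoothPoincare4.Theorems.SullivanDualWitnessChargeCapDefs
import Summits.SmoothPoincare4.SmoothPoincare4.Theorems.SullivanDualWitnessChargeV15SphereHomotopyAux1
import Literature.Topology.FourManifolds.HomotopySpheresGroupDischarge

/-!
# Stub `stub_sphereHomotopy` of crux `WitnessCharge` (stmt-SmoothPoincare4-7824), line `Sketch`
(skeleton v15, lead c8) — part 2: the homotopy from the compactified member to the far sphere

In the cap model `X = (Σ ∖ p) ∪ {‖t‖ < ρ} × ℂ_σ` of `CapData` (interface file
`SullivanDualWitnessChargeCapDefs`), the compactified pencil member at an admissible scale `lam`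
is the two-chart pair `U = sphereU u lam : ζ ↦ ι (u (lam ζ))`,
`V = sphereV u b lam : w ↦ ι (u (lam / w))`, `0 ↦ capPt b`, and the far sphere is the same for
the far flat line `farLine` (`Ycoord = (ξ, b_f)` exactly) at an admissible scale `lamf`. We prove
`stub_sphereHomotopy`: their glued maps `F`, `Ff : ℂP¹ → X` are homotopic.

Proof (two deformations of one chart each, glued by the generic lemmas of part 1,
`…V15SphereHomotopyAux1`):

1. *Slide the `V`-disc in the convex cap chart* (`stage1`). For `‖w‖ ≤ 2` the point `V w` lies
   in the cap chart, `V w = capInv (Q w)` with `Q = capCoord ∘ V` continuous on the disc and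
   `Q w = (1 / z(u(lam/w)), w(u(lam/w)))` for `w ≠ 0` (`AdmissibleScale`, `capInv_Ycoord`), while
   `Vf w = capInv (w / lamf, b_f)` (`Ycoord_farLine`). The deformation
   `W₁ (s, w) = capInv ((1 - s φ(‖w‖)) • Q w + s φ(‖w‖) • (w / lamf, b_f))` (`φ = 1` on
   `[0, 3/2]`, `= 0` on `[2, ∞)`), `= V w` for `‖w‖ ≥ 2`, is jointly continuous, starts at `V`,
   ends at a chart `V₁` equal to `Vf` on `‖w‖ ≤ 3/2`, and `V₁ w ∈ ι(Σ ∖ p)` for `0 < ‖w‖ ≤ 2` by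
   the cone estimate `helper_sphereHomotopy_keyEstimate` and `capInv_flat`.
2. *Move the complementary disc inside the contractible `Σ ∖ p`* (`helper_sphereHomotopy_stage2`
   of part 1). The complementary chart `U₁` of `V₁` (`helper_sphereHomotopy_extendInv`) agrees
   with `Uf` on `‖ζ‖ ≥ 2/3` and maps the closed unit disc into `ι(Σ ∖ p)`; `Σ ∖ p` is contractible
   (`HomotopySphere.contractibleSpace_compl_singleton_holds`), so `ιinv ∘ U₁ ≃ ιinv ∘ Uf` on the
   disc by a homotopy stationary on the unit circle (`helper_sphereHomotopy_relBoundary`), which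
   extends by `Uf` outside the disc.
3. The glued maps along both families are homotopic (`helper_sphereHomotopy_family`), and
   `F ≃ G ≃ Ff` with `G` the glued map of `(U₁, V₁)` (`helper_gluedExists`).

References: D. McDuff, D. Salamon, *J-holomorphic Curves and Symplectic Topology*, 2nd ed. (2012),
§4.2, §9.4; M. Gromov, Pseudo-holomorphic curves in symplectic manifolds, Invent. Math. 82 (1985),
§2.4.A.
-/

noncomputable section

-- the prescribed namespace `Summit.<P>.<Sub>.…` duplicates `SmoothPoincare4` (P = Sub)
set_option linter.dupNamespace false

open scoped Manifold ContDiff Topology unitInterval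
open Set Filter Literature.Geometry.Symplectic Literature.Topology.FourManifolds
  Literature.Topology.FourManifolds.ComplexProjectiveSpace

namespace Summit.SmoothPoincare4.SmoothPoincare4.Theorems.WitnessCharge.PencilIncompleteness

variable {S : HomotopySphere 4} {p : S.carrier}
  {J : ∀ x : punctured p, TangentSpace (𝓡 4) x →L[ℝ] TangentSpace (𝓡 4) x} {ε' : ℝ}

/-! ### The `V`-disc of an admissible sphere in the cap chart -/

/-- For an admissible scale `lam` of `u` and `0 < ‖w‖ ≤ 2`: `ξ = lam / w` has `‖ξ‖ ≥ 2`, the point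
`u ξ` lies in the punctured chart-ball with `‖z‖ > ρ⁻¹ + 1`, `‖z - ξ‖ ≤ 1` (`z = z(u ξ)`), and
`sphereV u b lam w = capInv (z⁻¹, w(u ξ))` with `‖z⁻¹‖ < ρ`. -/
private theorem sphereV_cap (D : CapData S p J ε') {u : ℂ → punctured p} (b : ℂ) {lam : ℝ}
    (hadm : D.AdmissibleScale u lam) {w : ℂ} (hw0 : w ≠ 0) (hw : ‖w‖ ≤ 2) :
    2 ≤ ‖(lam : ℂ) * w⁻¹‖ ∧
    ‖(Ycoord p (u ((lam : ℂ) * w⁻¹))).1 - (lam : ℂ) * w⁻¹‖ ≤ 1 ∧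
    D.sphereV u b lam w =
      D.capInv (((Ycoord p (u ((lam : ℂ) * w⁻¹))).1)⁻¹, (Ycoord p (u ((lam : ℂ) * w⁻¹))).2) ∧
    ‖((Ycoord p (u ((lam : ℂ) * w⁻¹))).1)⁻¹‖ < D.ρ := by
  have hlam : 0 < lam := by linarith [hadm.1]
  have hwpos : 0 < ‖w‖ := norm_pos_iff.2 hw0
  have hnorm : ‖(lam : ℂ) * w⁻¹‖ = lam * ‖w‖⁻¹ := by
    rw [norm_mul, norm_inv, Complex.norm_real, Real.norm_of_nonneg hlam.le]
  have h2 : lam / 2 ≤ ‖(lam : ℂ) * w⁻¹‖ := by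
    rw [hnorm, div_eq_mul_inv]
    exact mul_le_mul_of_nonneg_left (inv_anti₀ hwpos hw) hlam.le
  obtain ⟨hball, hz1, hz2⟩ := hadm.2 _ h2
  have hzρ : D.ρ⁻¹ < ‖(Ycoord p (u ((lam : ℂ) * w⁻¹))).1‖ := by linarith
  refine ⟨by linarith [hadm.1], hz2, ?_, ?_⟩
  · rw [D.sphereV_apply_of_ne u b lam hw0, D.capInv_Ycoord _ hball hzρ]
  · rw [norm_inv]
    exact inv_lt_of_inv_lt₀ D.ρ_pos hzρ

/-- The far sphere in the cap chart: for `‖w‖ ≤ 2`,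
`sphereV farLine b_f lamf w = capInv (w / lamf, b_f)` with `‖w / lamf‖ < ρ` (the far line has
`Ycoord = (ξ, b_f)` exactly, and `lamf / 2 > ρ⁻¹` by admissibility at `‖ξ‖ = lamf / 2`). -/
private theorem sphereV_far_cap (D : CapData S p J ε') (hε' : 0 < ε')
    (hball : Metric.closedBall (extChartAt (𝓡 4) p p) ε' ⊆ (extChartAt (𝓡 4) p).target)
    {bf : ℂ} (hbf : ε'⁻¹ < ‖bf‖) {lamf : ℝ}
    (hadm : D.AdmissibleScale (farLine hε' hball hbf) lamf) {w : ℂ} (hw : ‖w‖ ≤ 2) :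
    D.sphereV (farLine hε' hball hbf) bf lamf w = D.capInv ((lamf : ℂ)⁻¹ * w, bf) ∧
    ‖(lamf : ℂ)⁻¹ * w‖ < D.ρ := by
  have hlamf : 0 < lamf := by linarith [hadm.1]
  have hρ : 2 * lamf⁻¹ < D.ρ := by
    have h := (hadm.2 ((lamf / 2 : ℝ) : ℂ)
      (by rw [Complex.norm_real, Real.norm_of_nonneg (by positivity)])).2.1
    rw [Ycoord_farLine, Complex.norm_real, Real.norm_of_nonneg (by positivity)] at h
    have h' := inv_lt_of_inv_lt₀ D.ρ_pos (by linarith : D.ρ⁻¹ < lamf / 2)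
    rwa [inv_div, div_eq_mul_inv] at h'
  refine ⟨?_, ?_⟩
  · by_cases hw0 : w = 0
    · rw [hw0, mul_zero, D.sphereV_zero, D.capInv_zero]
    · obtain ⟨-, -, hV, -⟩ := sphereV_cap D bf hadm hw0 hw
      rw [hV, Ycoord_farLine, mul_inv, inv_inv]
  · rw [norm_mul, norm_inv, Complex.norm_real, Real.norm_of_nonneg hlamf.le]
    calc lamf⁻¹ * ‖w‖ ≤ lamf⁻¹ * 2 := mul_le_mul_of_nonneg_left hw (inv_nonneg.2 hlamf.le)
      _ = 2 * lamf⁻¹ := mul_comm _ _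
      _ < D.ρ := hρ

/-! ### Stage 1: sliding the `V`-disc onto the far sphere inside the cap chart -/

/-- **Stage 1.** A jointly continuous deformation `W` of the `V`-chart of the compactified member,
stationary (`= U ∘ (·)⁻¹`) on `‖w‖ ≥ 2`, from `V` to a chart that equals the far `V`-chart on
`‖w‖ ≤ 3/2` and stays in `ι(Σ ∖ p)` on `0 < ‖w‖ ≤ 2`: interpolate linearly in the cap
coordinates with the cutoff `φ(‖w‖)`, `φ = 1` on `[0, 3/2]`, `φ = 0` on `[2, ∞)`. -/
private theorem stage1 (D : CapData S p J ε') {u : ℂ → punctured p} (b : ℂ) {lam : ℝ}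
    (hadm : D.AdmissibleScale u lam) (hVc : Continuous (D.sphereV u b lam)) (hε' : 0 < ε')
    (hball : Metric.closedBall (extChartAt (𝓡 4) p p) ε' ⊆ (extChartAt (𝓡 4) p).target)
    {bf : ℂ} (hbf : ε'⁻¹ < ‖bf‖) {lamf : ℝ}
    (hadmf : D.AdmissibleScale (farLine hε' hball hbf) lamf) :
    ∃ W : I × ℂ → D.X, Continuous W ∧ (∀ w, W (0, w) = D.sphereV u b lam w) ∧
      (∀ (s : I) (w : ℂ), 2 ≤ ‖w‖ → W (s, w) = D.sphereU u lam w⁻¹) ∧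
      (∀ w, ‖w‖ ≤ 3 / 2 → W (1, w) = D.sphereV (farLine hε' hball hbf) bf lamf w) ∧
      (∀ w, w ≠ 0 → ‖w‖ ≤ 2 → W (1, w) ∈ range D.ι) := by
  classical
  have hlam : 0 < lam := by linarith [hadm.1]
  have hlamf : 0 < lamf := by linarith [hadmf.1]
  have hρ := D.ρ_pos
  -- the cap coordinates of the `V`-disc
  set Q : ℂ → ℂ × ℂ := fun w => D.capCoord (D.sphereV u b lam w) with hQ_def
  have hQw : ∀ w, w ≠ 0 → ‖w‖ ≤ 2 →
      Q w = (((Ycoord p (u ((lam : ℂ) * w⁻¹))).1)⁻¹, (Ycoord p (u ((lam : ℂ) * w⁻¹))).2) := by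
    intro w hw0 hw
    obtain ⟨-, -, hVw, hn⟩ := sphereV_cap D b hadm hw0 hw
    simp only [hQ_def, hVw]
    exact D.capCoord_capInv _ hn
  have hVQ : ∀ w, ‖w‖ ≤ 2 → D.sphereV u b lam w = D.capInv (Q w) ∧ ‖(Q w).1‖ < D.ρ := by
    intro w hw
    by_cases hw0 : w = 0
    · have hQ0 : Q w = (0, b) := by
        simp only [hQ_def, hw0, D.sphereV_zero, ← D.capInv_zero]
        exact D.capCoord_capInv _ (by simpa using hρ)
      rw [hQ0, hw0, D.sphereV_zero, D.capInv_zero]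
      exact ⟨rfl, by simpa using hρ⟩
    · obtain ⟨-, -, hVw, hn⟩ := sphereV_cap D b hadm hw0 hw
      rw [hQw w hw0 hw]
      exact ⟨hVw, hn⟩
  have hQc : ContinuousOn Q (Metric.closedBall 0 2) :=
    D.contMDiffOn_capCoord.continuousOn.comp hVc.continuousOn fun w hw =>
      ⟨Q w, (hVQ w (mem_closedBall_zero_iff.1 hw)).2, (hVQ w (mem_closedBall_zero_iff.1 hw)).1.symm⟩
  -- the far sphere in the cap chart
  have hVf : ∀ w, ‖w‖ ≤ 2 →
      D.sphereV (farLine hε' hball hbf) bf lamf w = D.capInv ((lamf : ℂ)⁻¹ * w, bf) ∧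
        ‖(lamf : ℂ)⁻¹ * w‖ < D.ρ := fun w hw => sphereV_far_cap D hε' hball hbf hadmf hw
  -- the cutoff `φ` and the interpolation parameter `τ = s φ(‖w‖)`
  set φ : ℝ → ℝ := fun r => max 0 (min 1 (4 - 2 * r)) with hφ_def
  have hφc : Continuous φ := by
    simp only [hφ_def]
    fun_prop
  have hφ0 : ∀ r, 0 ≤ φ r := fun r => le_max_left _ _
  have hφ1 : ∀ r, φ r ≤ 1 := fun r => max_le zero_le_one (min_le_left _ _)
  have hφone : ∀ r, r ≤ 3 / 2 → φ r = 1 := fun r hr => by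
    simp only [hφ_def]
    rw [min_eq_left (by linarith), max_eq_right zero_le_one]
  have hφzero : ∀ r, 2 ≤ r → φ r = 0 := fun r hr => by
    simp only [hφ_def]
    exact max_eq_left ((min_le_right _ _).trans (by linarith))
  set τ : I × ℂ → ℝ := fun q => (q.1 : ℝ) * φ ‖q.2‖ with hτ_def
  have hτc : Continuous τ :=
    (continuous_subtype_val.comp continuous_fst).mul
      (hφc.comp (continuous_norm.comp continuous_snd))
  have hτ0 : ∀ q, 0 ≤ τ q := fun q => mul_nonneg q.1.2.1 (hφ0 _)
  have hτ1 : ∀ q, τ q ≤ 1 := fun q => mul_le_one₀ q.1.2.2 (hφ0 _) (hφ1 _)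
  -- the target chart values and the interpolation in cap coordinates
  set T : ℂ → ℂ × ℂ := fun w => ((lamf : ℂ)⁻¹ * w, bf) with hT_def
  have hTc : Continuous T := by
    simp only [hT_def]
    fun_prop
  set qf : I × ℂ → ℂ × ℂ := fun q => (1 - τ q) • Q q.2 + τ q • T q.2 with hqf_def
  have hqfc : ContinuousOn qf {q : I × ℂ | ‖q.2‖ ≤ 2} := by
    have hQ2 : ContinuousOn (fun q : I × ℂ => Q q.2) {q : I × ℂ | ‖q.2‖ ≤ 2} :=
      hQc.comp continuousOn_snd fun q hq => mem_closedBall_zero_iff.2 hq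
    exact ((continuous_const.sub hτc).continuousOn.smul hQ2).add
      (hτc.smul (hTc.comp continuous_snd)).continuousOn
  have hqf1 : ∀ q : I × ℂ, ‖q.2‖ ≤ 2 → ‖(qf q).1‖ < D.ρ := by
    intro q hq
    have h := convex_ball (0 : ℂ) D.ρ (mem_ball_zero_iff.2 (hVQ q.2 hq).2)
      (mem_ball_zero_iff.2 (hVf q.2 hq).2) (sub_nonneg.2 (hτ1 q)) (hτ0 q) (sub_add_cancel 1 (τ q))
    simpa only [hqf_def, Prod.fst_add, Prod.smul_fst, mem_ball_zero_iff] using h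
  have hqf_zero : ∀ q : I × ℂ, τ q = 0 → qf q = Q q.2 := fun q h => by
    simp only [hqf_def, h, sub_zero, one_smul, zero_smul, add_zero]
  have hqf_one : ∀ q : I × ℂ, τ q = 1 → qf q = T q.2 := fun q h => by
    simp only [hqf_def, h, sub_self, zero_smul, one_smul, zero_add]
  -- the deformation
  refine ⟨fun q => if ‖q.2‖ ≤ 2 then D.capInv (qf q) else D.sphereV u b lam q.2, ?_, ?_, ?_, ?_, ?_⟩
  · refine continuous_if_le (continuous_norm.comp continuous_snd) continuous_const
      (D.contMDiffOn_capInv.continuousOn.comp hqfc fun q hq => hqf1 q hq)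
      (hVc.comp continuous_snd).continuousOn ?_
    rintro ⟨s, w⟩ (hw : ‖w‖ = 2)
    show D.capInv (qf (s, w)) = D.sphereV u b lam w
    rw [hqf_zero (s, w) (by simp only [hτ_def, hw, hφzero 2 le_rfl, mul_zero]), (hVQ w hw.le).1]
  · intro w
    dsimp only
    split_ifs with hw
    · rw [hqf_zero (0, w) (by simp [hτ_def]), (hVQ w hw).1]
    · rfl
  · intro s w hw
    have hw0 : w ≠ 0 := by
      rintro rfl
      norm_num at hw
    dsimp only
    split_ifs with hw'
    · rw [hqf_zero (s, w) (by simp only [hτ_def, hφzero _ hw, mul_zero]), ← (hVQ w hw').1,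
        D.sphereV_apply_of_ne _ _ _ hw0, D.sphereU_apply]
    · rw [D.sphereV_apply_of_ne _ _ _ hw0, D.sphereU_apply]
  · intro w hw
    have hw2 : ‖w‖ ≤ 2 := by linarith
    dsimp only
    rw [if_pos hw2, hqf_one (1, w) (by simp [hτ_def, hφone _ hw]), (hVf w hw2).1]
  · intro w hw0 hw
    dsimp only
    rw [if_pos hw]
    obtain ⟨hξ2, hz2, -, -⟩ := sphereV_cap D b hadm hw0 hw
    have hne : (qf (1, w)).1 ≠ 0 := by
      have h := helper_sphereHomotopy_keyEstimate (τ (1, w)) lam lamf w _ (hτ0 _) (hτ1 _) hlam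
        hlamf hw0 hξ2 hz2
      have h1 : (qf (1, w)).1 =
          ((1 - τ (1, w) : ℝ) : ℂ) * ((Ycoord p (u ((lam : ℂ) * w⁻¹))).1)⁻¹ +
            (τ (1, w) : ℂ) * ((lamf : ℂ)⁻¹ * w) := by
        simp only [hqf_def, Prod.fst_add, Prod.smul_fst, hQw w hw0 hw, hT_def, Complex.real_smul]
      rwa [h1]
    obtain ⟨x, hx, -, -⟩ := D.capInv_flat (qf (1, w)) (hqf1 (1, w) hw) hne
    exact ⟨x, hx.symm⟩

/-! ### The stub -/

/-- **Stub S4 — the compactified member is homotopic to the far sphere** (as glued maps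
`ℂP¹ → X`; registered stub `stub_sphereHomotopy` of skeleton v15, signature verbatim): slide the
`V`-disc onto the far sphere inside the convex cap chart (`stage1`: by `AdmissibleScale` the
interpolated `t`-coordinate stays in a cone off `0` for `0 < ‖w‖ ≤ 2`, so the slid disc meets the
added line `E` only at `w = 0`), then move the complementary disc, which lies in `ι(Σ ∖ p)` and
agrees with the far sphere near the unit circle, inside the contractible `Σ ∖ p`
(`helper_sphereHomotopy_stage2`, `HomotopySphere.contractibleSpace_compl_singleton_holds`); glued
maps along both families are homotopic (`helper_sphereHomotopy_family`). The hypotheses on `J`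
and the pencil-member property are not needed beyond admissibility and continuity of the
charts. -/
theorem stub_sphereHomotopy :
    ∀ (S : HomotopySphere 4) (p : S.carrier)
      (J : ∀ x : punctured p, TangentSpace (𝓡 4) x →L[ℝ] TangentSpace (𝓡 4) x) (ε' : ℝ)
      (hε' : 0 < ε')
      (hball : Metric.closedBall (extChartAt (𝓡 4) p p) ε' ⊆ (extChartAt (𝓡 4) p).target),
      (∀ (x : punctured p) (v : TangentSpace (𝓡 4) x), J x (J x v) = -v) →
      (∀ x₀ : punctured p, ContMDiffAt (𝓡 4) 𝓘(ℝ, EuclideanSpace ℝ (Fin 4) →L[ℝ] EuclideanSpace ℝ (Fin 4)) ∞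
        (inTangentCoordinates (𝓡 4) (𝓡 4) (id : punctured p → punctured p) id (fun x => J x) x₀) x₀) →
      (∀ x : punctured p, InPuncturedChartBall p ε' x →
        ∀ (v : TangentSpace (𝓡 4) x) (b : EuclideanSpace ℝ (Fin 4)),
          inner ℝ (fderiv ℝ inversion (extChartAt (𝓡 4) p x.1 - extChartAt (𝓡 4) p p)
            (mfderiv (𝓡 4) 𝓘(ℝ, EuclideanSpace ℝ (Fin 4))
              (fun z : punctured p => extChartAt (𝓡 4) p z.1) x (J x v))) b
          = stdSymplecticForm (fderiv ℝ inversion (extChartAt (𝓡 4) p x.1 - extChartAt (𝓡 4) p p)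
            (mfderiv (𝓡 4) 𝓘(ℝ, EuclideanSpace ℝ (Fin 4))
              (fun z : punctured p => extChartAt (𝓡 4) p z.1) x v)) b) →
      ∀ (D : CapData S p J ε') (u : ℂ → punctured p) (b : ℂ) (lam : ℝ),
      IsPencilMember J u b → D.AdmissibleScale u lam →
      ContMDiff 𝓘(ℝ, ℂ) (𝓡 4) ∞ (D.sphereU u lam) → ContMDiff 𝓘(ℝ, ℂ) (𝓡 4) ∞ (D.sphereV u b lam) →
      ∀ (bf : ℂ) (hbf : ε'⁻¹ < ‖bf‖) (lamf : ℝ), D.AdmissibleScale (farLine hε' hball hbf) lamf →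
      ContMDiff 𝓘(ℝ, ℂ) (𝓡 4) ∞ (D.sphereU (farLine hε' hball hbf) lamf) →
      ContMDiff 𝓘(ℝ, ℂ) (𝓡 4) ∞ (D.sphereV (farLine hε' hball hbf) bf lamf) →
      ∀ (F Ff : C(ComplexProjectiveSpace 1, D.X)),
      (∀ q, CoordNeZero 0 q → F q = D.sphereU u lam (affineCoordComplex 0 q 0)) →
      (∀ q, CoordNeZero 1 q → F q = D.sphereV u b lam (affineCoordComplex 1 q 0)) →
      (∀ q, CoordNeZero 0 q → Ff q = D.sphereU (farLine hε' hball hbf) lamf (affineCoordComplex 0 q 0)) →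
      (∀ q, CoordNeZero 1 q → Ff q = D.sphereV (farLine hε' hball hbf) bf lamf (affineCoordComplex 1 q 0)) →
      F.Homotopic Ff := by
  intro S p J ε' hε' hball _ _ _ D u b lam _ hadm hUc hVc bf hbf lamf hadmf hUfc hVfc F Ff hF0 hF1
    hFf0 hFf1
  -- the two-chart relations `V z = U z⁻¹`
  have hVU : ∀ z : ℂ, z ≠ 0 → D.sphereV u b lam z = D.sphereU u lam z⁻¹ := fun z hz => by
    rw [D.sphereV_apply_of_ne _ _ _ hz, D.sphereU_apply]
  have hVUf : ∀ z : ℂ, z ≠ 0 →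
      D.sphereV (farLine hε' hball hbf) bf lamf z = D.sphereU (farLine hε' hball hbf) lamf z⁻¹ :=
    fun z hz => by rw [D.sphereV_apply_of_ne _ _ _ hz, D.sphereU_apply]
  -- Stage 1: slide the `V`-disc; `Wc1` is the complementary chart of the slid family
  obtain ⟨W1, hW1c, hW10, hW1st, hW11, hW1r⟩ :=
    stage1 D b hadm hVc.continuous hε' hball hbf hadmf
  obtain ⟨Wc1, hWc1c, hc1, hWc1U⟩ := helper_sphereHomotopy_extendInv D.X W1 (D.sphereU u lam) 2
    hW1c hUc.continuous two_pos hW1st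
  have hc1' : ∀ (s : I) (ζ : ℂ), ζ ≠ 0 → Wc1 (s, ζ) = W1 (s, ζ⁻¹) := fun s ζ hζ => by
    rw [hc1 s ζ⁻¹ (inv_ne_zero hζ), inv_inv]
  -- the intermediate sphere `(Wc1 (1, ·), W1 (1, ·))`
  have hmidc : Continuous fun ζ => Wc1 (1, ζ) := hWc1c.comp (Continuous.prodMk_right 1)
  have hmid_eq : ∀ ζ, 2 / 3 ≤ ‖ζ‖ → Wc1 (1, ζ) = D.sphereU (farLine hε' hball hbf) lamf ζ := by
    intro ζ hζ
    have hζ0 : ζ ≠ 0 := by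
      rintro rfl
      norm_num at hζ
    have hn : ‖ζ⁻¹‖ ≤ 3 / 2 := by
      rw [norm_inv]
      exact inv_le_of_inv_le₀ (by norm_num) (by linarith)
    rw [hc1' 1 ζ hζ0, hW11 _ hn, hVUf _ (inv_ne_zero hζ0), inv_inv]
  have hmid_range : ∀ ζ, ‖ζ‖ ≤ 1 → Wc1 (1, ζ) ∈ range D.ι := by
    intro ζ hζ
    by_cases h : ‖ζ‖ ≤ 2⁻¹
    · exact ⟨_, (hWc1U 1 ζ h).symm⟩
    · have hζ0 : ζ ≠ 0 := by
        rintro rfl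
        exact h (by norm_num)
      rw [hc1' 1 ζ hζ0]
      refine hW1r ζ⁻¹ (inv_ne_zero hζ0) ?_
      rw [norm_inv]
      exact inv_le_of_inv_le₀ two_pos (not_le.1 h).le
  have hfar_range : ∀ ζ, D.sphereU (farLine hε' hball hbf) lamf ζ ∈ range D.ι := fun ζ => ⟨_, rfl⟩
  -- Stage 2: move the complementary disc in `Σ ∖ p`; `Wc2` is the complementary chart
  haveI : ContractibleSpace (punctured p) :=
    HomotopySphere.contractibleSpace_compl_singleton_holds 4 S p (by norm_num)
  obtain ⟨W2, hW2c, hW20, hW21, hW2st⟩ := helper_sphereHomotopy_stage2 D.X (punctured p) D.ι D.ιinv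
    (fun ζ => Wc1 (1, ζ)) (D.sphereU (farLine hε' hball hbf) lamf) D.isOpenEmbedding_ι.continuous
    D.contMDiffOn_ιinv.continuousOn D.ιinv_ι hmidc hUfc.continuous hmid_eq hmid_range hfar_range
  obtain ⟨Wc2, hWc2c, hc2, hWc2V⟩ := helper_sphereHomotopy_extendInv D.X W2
    (D.sphereV (farLine hε' hball hbf) bf lamf) 1 hW2c hVfc.continuous one_pos (fun s w hw => by
      have hw0 : w ≠ 0 := by
        rintro rfl
        norm_num at hw
      rw [hW2st s w hw, hVUf _ (inv_ne_zero hw0), inv_inv])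
  have hc2' : ∀ (s : I) (w : ℂ), w ≠ 0 → Wc2 (s, w) = W2 (s, w⁻¹) := fun s w hw => by
    rw [hc2 s w⁻¹ (inv_ne_zero hw), inv_inv]
  -- the glued map of the intermediate sphere
  obtain ⟨G, hG0, hG1⟩ := GromovRecognitionRelEnd.CrossCapLaurent.helper_gluedExists D.X
    (fun ζ => Wc1 (1, ζ)) (fun w => W1 (1, w)) hmidc (hW1c.comp (Continuous.prodMk_right 1))
    fun z hz => hc1 1 z hz
  -- `F ≃ G` along stage 1
  have hFG : F.Homotopic G := by
    refine helper_sphereHomotopy_family D.X Wc1 W1 F G hWc1c hW1c hc1 ?_ ?_ hG0 hG1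
    · intro q hq
      rw [hF0 q hq]
      by_cases h : ‖affineCoordComplex 0 q 0‖ ≤ 2⁻¹
      · exact (hWc1U 0 _ h).symm
      · have hζ0 : affineCoordComplex 0 q 0 ≠ 0 := by
          intro h0
          rw [h0] at h
          exact h (by norm_num)
        rw [hc1' 0 _ hζ0, hW10, hVU _ (inv_ne_zero hζ0), inv_inv]
    · intro q hq
      rw [hF1 q hq, hW10]
  -- `G ≃ Ff` along stage 2
  have hGFf : G.Homotopic Ff := by
    refine helper_sphereHomotopy_family D.X W2 Wc2 G Ff hW2c hWc2c hc2' ?_ ?_ ?_ ?_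
    · intro q hq
      rw [hG0 q hq, hW20]
    · intro q hq
      rw [hG1 q hq]
      by_cases h : ‖affineCoordComplex 1 q 0‖ ≤ 1⁻¹
      · rw [hWc2V 0 _ h, hW11 _ (by rw [inv_one] at h; linarith)]
      · have hw0 : affineCoordComplex 1 q 0 ≠ 0 := by
          intro h0
          rw [h0] at h
          exact h (by norm_num)
        rw [hc2' 0 _ hw0, hW20, hc1' 1 _ (inv_ne_zero hw0), inv_inv]
    · intro q hq
      rw [hFf0 q hq, hW21]
    · intro q hq
      rw [hFf1 q hq]
      by_cases h : ‖affineCoordComplex 1 q 0‖ ≤ 1⁻¹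
      · rw [hWc2V 1 _ h]
      · have hw0 : affineCoordComplex 1 q 0 ≠ 0 := by
          intro h0
          rw [h0] at h
          exact h (by norm_num)
        rw [hc2' 1 _ hw0, hW21, hVUf _ hw0]
  exact hFG.trans hGFf

end Summit.SmoothPoincare4.SmoothPoincare4.Theorems.WitnessCharge.PencilIncompleteness

end
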